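import Summits.Ventures.PercRepro.C025ProfileTopHall

/-!
# THE DISJOINTNESS LEMMA IN THE LANGUAGE OF `M` ITSELF: COINDEPENDENT FAMILIES AND SPANNING SUPERSETS (night-3 g21)

For every finite matroid `M` and every family `𝒜` of COINDEPENDENT sets (sets whose complement is spanning —
no rank restriction), the spanning sets containing a member of `𝒜` are at least as many as the members:
`#𝒜 ≤ #{S ⊆ E : M.Spanning S ∧ ∃ B ∈ 𝒜, B ⊆ S}`.  This is the disjointness lemma of `C025ProfileTopHallDisjoint`
for `M✶` (coindependent = independent in `M✶`, spanning = complement of an independent set of `M✶`), stated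
without the profile vocabulary so that other lanes (the shadow forms) can use it directly.
* **`card_coindep_le_card_spanning (𝒜) (h𝒜 : ∀ B ∈ 𝒜, M.Coindep B) : #𝒜 ≤ #{S ⊆ gr M : M.Spanning S ∧ ∃ B ∈ 𝒜, B ⊆ S}`**.
No `def`, no `instance`, no notation.  Axioms: standard.
-/

open scoped Matroid

namespace PercRepro

open Set Finset ThmH

namespace TopHall

variable {α : Type} [DecidableEq α] {M : Matroid α} [M.Finite]

open scoped Classical in
/-- **Coindependent families have at least as many spanning supersets**: for every family `𝒜` of coindependent
sets (complements spanning), `#𝒜 ≤ #{S : M.Spanning S ∧ ∃ B ∈ 𝒜, B ⊆ S}` — the disjointness lemma in `M✶`,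
the candidates `T` mapped to `E ∖ T`. -/
theorem card_coindep_le_card_spanning (𝒜 : Finset (Finset α)) (h𝒜 : ∀ B ∈ 𝒜, M.Coindep (B : Set α)) :
    𝒜.card ≤ ((gr M).powerset.filter
      (fun S : Finset α => M.Spanning (S : Set α) ∧ ∃ B ∈ 𝒜, B ⊆ S)).card := by
  have hind : ∀ B ∈ 𝒜, (M✶).Indep (B : Set α) := fun B hB => Matroid.coindep_def.1 (h𝒜 B hB)
  have hdisj := card_le_card_indep_disjoint (M✶) 𝒜 hind
  have hmap : ((gr (M✶)).powerset.filter (fun T : Finset α => (M✶).Indep (T : Set α) ∧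
      ∃ B ∈ 𝒜, Disjoint T B)).card ≤
      ((gr M).powerset.filter (fun S : Finset α => M.Spanning (S : Set α) ∧ ∃ B ∈ 𝒜, B ⊆ S)).card := by
    apply Finset.card_le_card_of_injOn (fun T : Finset α => gr M \ T)
    · intro T hT
      rw [Finset.mem_coe, Finset.mem_filter, Finset.mem_powerset, gr_dual] at hT
      obtain ⟨hTg, hTi, B, hB, hdis⟩ := hT
      rw [Finset.mem_coe, Finset.mem_filter, Finset.mem_powerset]
      refine ⟨Finset.sdiff_subset, ?_, B, hB, ?_⟩
      · have h1 : M.Spanning (M.E \ (T : Set α)) := (Matroid.coindep_def.2 hTi).compl_spanning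
        rw [Finset.coe_sdiff, coe_gr]
        exact h1
      · rw [Finset.subset_sdiff]
        refine ⟨?_, hdis.symm⟩
        have hBg : (B : Set α) ⊆ M.E := (h𝒜 B hB).subset_ground
        rw [← coe_gr] at hBg
        exact Finset.coe_subset.1 hBg
    · intro T hT T' hT' heq
      rw [Finset.mem_coe, Finset.mem_filter, Finset.mem_powerset, gr_dual] at hT hT'
      simp only at heq
      rw [← Finset.sdiff_sdiff_eq_self hT.1, ← Finset.sdiff_sdiff_eq_self hT'.1, heq]
  exact hdisj.trans hmap

end TopHall

end PercRepro
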